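import Summits.AtomisticToContinuum.Crystallization.Theses.FluxTubeKepler
import Summits.AtomisticToContinuum.Crystallization.Theorems.FluxTubeKeplerFluxCellKeplerSplit

/-!
# Line `split-thomson` — skeleton for the BC2-redirect piece X₁ = `FluxTubeDomination` of crux `FluxTubeKepler.FluxCellKepler`

Crux (after `route edit --split FluxCellKepler`): `FluxTubeDomination` = Thomson's principle in
`ℝ⁸ = ℝ³ × ℝ⁵` for arbitrary admissible fields, localised to pairwise disjoint measurable cells:
`Σ_i Σ_(j≠i) r_ij⁻⁶ ≤ 2π⁴ Σ_i (∫_(Ω_i×ℝ⁵) ‖G‖² − t_a(x_i))` for every `L²` field `G` on `ℝ⁸`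
vanishing off the tubes with weak divergence = total smeared charge.  The cut follows the classical
proof: NEWTON (the free field of the smeared charges has energy `≥ Σ_i t_a(x_i) + (2π⁴)⁻¹ ΣΣ r⁻⁶`,
disjoint smeared balls interacting as point charges for the kernel `|y|⁻⁶ = 2π⁴ Φ₈`) and
THOMSON (a weak gradient with the same divergence is the `L²`-shortest field; localisation to the
disjoint tubes by additivity of the integral).  Stubs:

* `stub_trueFieldLowerBound` (L) — existence of the free field `E_true` of the total smeared charge
  as an `L²` field with the prescribed weak divergence, `L²`-ORTHOGONAL to every weakly
  divergence-free `L²` field (it is the weak gradient `∇(Φ₈ ∗ ρ_total)`, `∇u ~ |y|⁻⁷ ∈ L²(ℝ⁸)`,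
  density of `C¹_c` in `Ḣ¹`), with the Newton lower bound
  `Σ_i t_a(x_i) + (2π⁴)⁻¹ Σ_i site₆(x)_i ≤ ∫ ‖E_true‖²` (self terms `≥ t_a` because `t_a` is an
  infimum over a class containing each single-charge field; cross terms `= Φ₈(x_i − x_j)` exactly by
  the mean-value property on disjoint balls, `2a < r_ij`).
* `stub_confinedEnergyBound` (M) — `L²` Pythagoras + localisation: if `E` is orthogonal to weakly
  divergence-free fields and `G` has the same weak divergence and vanishes off pairwise disjoint
  measurable tubes, then `∫‖E‖² ≤ Σ_i ∫_(tube_i) ‖G‖²` (`‖G‖² = ‖E‖² + ‖G−E‖² + 2⟪E, G−E⟫`,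
  the cross term integrates to `0`; `∫_(ℝ⁸) ‖G‖² = Σ_i ∫_(tube_i) ‖G‖²`).

`FluxTubeDomination_of : stub₁ → stub₂ → FluxTubeDomination` is sorry-free (algebra).
-/

/-! ### Stand-in for the child decl (the split is filed, not yet applied)
`FluxTubeDomination` below is VERBATIM the statement filed for the child `FluxTubeKepler.FluxTubeDomination`
in `children.json` (= hypothesis `h₁` of the landed assembly `FluxCellKeplerSplit.FluxCellKepler_of_subs`,
p168076; `feeds_assembly` certifies this by `exact`).  Once `route edit --split FluxCellKepler` is applied,
delete the stand-in and let `FluxTubeDomination_of` conclude the route decl. -/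

namespace Summit.AtomisticToContinuum.Crystallization.Cruxes.FluxCellKepler.SplitThomson

open scoped BigOperators
open MeasureTheory Literature.MathematicalPhysics.StatisticalMechanics

/-- STAND-IN (verbatim the filed child statement `FluxTubeKepler.FluxTubeDomination`). [conjecture] -/
def FluxTubeDomination : Prop :=
  let ι : EuclideanSpace ℝ (Fin 3) → EuclideanSpace ℝ (Fin 8) := fun v => (EuclideanSpace.equiv (Fin 8) ℝ).symm (fun k => if h : (k : ℕ) < 3 then v ⟨k, h⟩ else 0); let π : EuclideanSpace ℝ (Fin 8) → EuclideanSpace ℝ (Fin 3) := fun y => (EuclideanSpace.equiv (Fin 3) ℝ).symm (fun k => y (Fin.castLE (by norm_num) k)); let t : ℝ → EuclideanSpace ℝ (Fin 3) → ℝ := fun a x₀ => sInf {e : ℝ | ∃ F : EuclideanSpace ℝ (Fin 8) → EuclideanSpace ℝ (Fin 8), MemLp F 2 volume ∧ (∀ φ : EuclideanSpace ℝ (Fin 8) → ℝ, ContDiff ℝ 1 φ → HasCompactSupport φ → ∫ y, inner ℝ (F y) (gradient φ y) = -(((volume (Metric.ball (ι x₀) a)).toReal)⁻¹ * ∫ y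 in Metric.ball (ι x₀) a, φ y)) ∧ e = ∫ y, ‖F y‖ ^ 2}; ∀ a : ℝ, 0 < a → ∀ (N : ℕ) (x : Fin N → EuclideanSpace ℝ (Fin 3)), (∀ i j, i ≠ j → 2 * a < dist (x i) (x j)) → ∀ (Ω : Fin N → Set (EuclideanSpace ℝ (Fin 3))) (G : EuclideanSpace ℝ (Fin 8) → EuclideanSpace ℝ (Fin 8)), (Pairwise fun i j => Disjoint (Ω i) (Ω j)) → (∀ i, MeasurableSet (Ω i)) → MemLp G 2 volume → (∀ y, π y ∉ (⋃ i, Ω i) → G y = 0) → (∀ φ : EuclideanSpace ℝ (Fin 8) → ℝ, ContDiff ℝ 1 φ → HasCompactSupport φ → ∫ y, inner ℝ (G y) (gradient φ y) = -∑ i, ((volume (Metric.ball (ι (x i)) a)).toReal)⁻¹ * ∫ y in Metric.ball (ι (x i)) a, φ y) → ∑ i, siteEnergy (fun r => (r⁻¹) ^ 6) x i ≤ 2 * Real.pi ^ 4 * ∑ i, ((∫ y in {y | π y ∈ Ω i}, ‖G y‖ ^ 2) - t a (x i))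

/-- **Stub 1 — the free field and Newton's lower bound** (see module docstring). [folklore] -/
theorem stub_trueFieldLowerBound :
    let ι : EuclideanSpace ℝ (Fin 3) → EuclideanSpace ℝ (Fin 8) := fun v => (EuclideanSpace.equiv (Fin 8) ℝ).symm (fun k => if h : (k : ℕ) < 3 then v ⟨k, h⟩ else 0); let π : EuclideanSpace ℝ (Fin 8) → EuclideanSpace ℝ (Fin 3) := fun y => (EuclideanSpace.equiv (Fin 3) ℝ).symm (fun k => y (Fin.castLE (by norm_num) k)); let t : ℝ → EuclideanSpace ℝ (Fin 3) → ℝ := fun a x₀ => sInf {e : ℝ | ∃ F : EuclideanSpace ℝ (Fin 8) → EuclideanSpace ℝ (Fin 8), MemLp F 2 volume ∧ (∀ φ : EuclideanSpace ℝ (Fin 8) → ℝ, ContDiff ℝ 1 φ → HasCompactSupport φ → ∫ y, inner ℝ (F y) (gradient φ y) = -(((volume (Metric.ball (ι x₀) a)).toReal)⁻¹ * ∫ y in Metric.ball (ι x₀) a, φ y)) ∧ e = ∫ y, ‖F y‖ ^ 2}; ∀ a : ℝ, 0 < a → ∀ (N : ℕ) (x : Fin N → EuclideanSpace ℝ (Fin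 3)), (∀ i j, i ≠ j → 2 * a < dist (x i) (x j)) → ∃ E : EuclideanSpace ℝ (Fin 8) → EuclideanSpace ℝ (Fin 8), MemLp E 2 volume ∧ (∀ φ : EuclideanSpace ℝ (Fin 8) → ℝ, ContDiff ℝ 1 φ → HasCompactSupport φ → ∫ y, inner ℝ (E y) (gradient φ y) = -∑ i, ((volume (Metric.ball (ι (x i)) a)).toReal)⁻¹ * ∫ y in Metric.ball (ι (x i)) a, φ y) ∧ (∀ H : EuclideanSpace ℝ (Fin 8) → EuclideanSpace ℝ (Fin 8), MemLp H 2 volume → (∀ φ : EuclideanSpace ℝ (Fin 8) → ℝ, ContDiff ℝ 1 φ → HasCompactSupport φ → ∫ y, inner ℝ (H y) (gradient φ y) = 0) → ∫ y, inner ℝ (E y) (H y) = 0) ∧ ∑ i, t a (x i) + (2 * Real.pi ^ 4)⁻¹ * ∑ i, siteEnergy (fun r => (r⁻¹) ^ 6) x i ≤ ∫ y, ‖E y‖ ^ 2 := by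
  sorry

/-- **Stub 2 — confined-energy bound (L² Pythagoras + additivity over disjoint measurable tubes)**
(see module docstring). [folklore] -/
theorem stub_confinedEnergyBound :
    let π : EuclideanSpace ℝ (Fin 8) → EuclideanSpace ℝ (Fin 3) := fun y => (EuclideanSpace.equiv (Fin 3) ℝ).symm (fun k => y (Fin.castLE (by norm_num) k)); ∀ (N : ℕ) (Ω : Fin N → Set (EuclideanSpace ℝ (Fin 3))) (E G : EuclideanSpace ℝ (Fin 8) → EuclideanSpace ℝ (Fin 8)), (Pairwise fun i j => Disjoint (Ω i) (Ω j)) → (∀ i, MeasurableSet (Ω i)) → MemLp E 2 volume → MemLp G 2 volume → (∀ H : EuclideanSpace ℝ (Fin 8) → EuclideanSpace ℝ (Fin 8), MemLp H 2 volume → (∀ φ : EuclideanSpace ℝ (Fin 8) → ℝ, ContDiff ℝ 1 φ → HasCompactSupport φ → ∫ y, inner ℝ (H y) (gradient φ y) = 0) → ∫ y, inner ℝ (E y) (H y) = 0) → (∀ φ : EuclideanSpace ℝ (Fin 8) → ℝ, ContDiff ℝ 1 φ → HasCompactSupport φ → ∫ y, inner ℝ (E y) (gradient φ y) = ∫ y,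 inner ℝ (G y) (gradient φ y)) → (∀ y, π y ∉ (⋃ i, Ω i) → G y = 0) → ∫ y, ‖E y‖ ^ 2 ≤ ∑ i, ∫ y in {y | π y ∈ Ω i}, ‖G y‖ ^ 2 := by
  sorry

/-- Statement of `stub_trueFieldLowerBound` (verbatim). [folklore] -/
def Sig.stub_trueFieldLowerBound : Prop :=
  let ι : EuclideanSpace ℝ (Fin 3) → EuclideanSpace ℝ (Fin 8) := fun v => (EuclideanSpace.equiv (Fin 8) ℝ).symm (fun k => if h : (k : ℕ) < 3 then v ⟨k, h⟩ else 0); let π : EuclideanSpace ℝ (Fin 8) → EuclideanSpace ℝ (Fin 3) := fun y => (EuclideanSpace.equiv (Fin 3) ℝ).symm (fun k => y (Fin.castLE (by norm_num) k)); let t : ℝ → EuclideanSpace ℝ (Fin 3) → ℝ := fun a x₀ => sInf {e : ℝ | ∃ F : EuclideanSpace ℝ (Fin 8) → EuclideanSpace ℝ (Fin 8), MemLp F 2 volume ∧ (∀ φ : EuclideanSpace ℝ (Fin 8) → ℝ, ContDiff ℝ 1 φ → HasCompactSupport φ → ∫ y, inner ℝ (F y) (gradient φ y) = -(((volume (Metric.ball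 (ι x₀) a)).toReal)⁻¹ * ∫ y in Metric.ball (ι x₀) a, φ y)) ∧ e = ∫ y, ‖F y‖ ^ 2}; ∀ a : ℝ, 0 < a → ∀ (N : ℕ) (x : Fin N → EuclideanSpace ℝ (Fin 3)), (∀ i j, i ≠ j → 2 * a < dist (x i) (x j)) → ∃ E : EuclideanSpace ℝ (Fin 8) → EuclideanSpace ℝ (Fin 8), MemLp E 2 volume ∧ (∀ φ : EuclideanSpace ℝ (Fin 8) → ℝ, ContDiff ℝ 1 φ → HasCompactSupport φ → ∫ y, inner ℝ (E y) (gradient φ y) = -∑ i, ((volume (Metric.ball (ι (x i)) a)).toReal)⁻¹ * ∫ y in Metric.ball (ι (x i)) a, φ y) ∧ (∀ H : EuclideanSpace ℝ (Fin 8) → EuclideanSpace ℝ (Fin 8), MemLp H 2 volume → (∀ φ : EuclideanSpace ℝ (Fin 8) → ℝ, ContDiff ℝ 1 φ → HasCompactSupport φ → ∫ y, inner ℝ (H y) (gradient φ y) = 0) → ∫ y, inner ℝ (E y) (H y) = 0) ∧ ∑ i, t a (x i) + (2 * Real.pi ^ 4)⁻¹ * ∑ i, siteEnergy (fun r => (r⁻¹)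 ^ 6) x i ≤ ∫ y, ‖E y‖ ^ 2

/-- Statement of `stub_confinedEnergyBound` (verbatim). [folklore] -/
def Sig.stub_confinedEnergyBound : Prop :=
  let π : EuclideanSpace ℝ (Fin 8) → EuclideanSpace ℝ (Fin 3) := fun y => (EuclideanSpace.equiv (Fin 3) ℝ).symm (fun k => y (Fin.castLE (by norm_num) k)); ∀ (N : ℕ) (Ω : Fin N → Set (EuclideanSpace ℝ (Fin 3))) (E G : EuclideanSpace ℝ (Fin 8) → EuclideanSpace ℝ (Fin 8)), (Pairwise fun i j => Disjoint (Ω i) (Ω j)) → (∀ i, MeasurableSet (Ω i)) → MemLp E 2 volume → MemLp G 2 volume → (∀ H : EuclideanSpace ℝ (Fin 8) → EuclideanSpace ℝ (Fin 8), MemLp H 2 volume → (∀ φ : EuclideanSpace ℝ (Fin 8) → ℝ, ContDiff ℝ 1 φ → HasCompactSupport φ → ∫ y, inner ℝ (H y) (gradient φ y) = 0) → ∫ y, inner ℝ (E y) (H y) = 0) → (∀ φ : EuclideanSpace ℝ (Fin 8) → ℝ, ContDiff ℝ 1 φ → HasCompactSupport φ → ∫ y, inner ℝ (E y) (gradient φ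 y) = ∫ y, inner ℝ (G y) (gradient φ y)) → (∀ y, π y ∉ (⋃ i, Ω i) → G y = 0) → ∫ y, ‖E y‖ ^ 2 ≤ ∑ i, ∫ y in {y | π y ∈ Ω i}, ‖G y‖ ^ 2

/-- **Assembly** (sorry-free): the crux `FluxTubeKepler.FluxTubeDomination` BY NAME from the two stub
statements: take `E_true` from stub 1; stubs 1/2 give
`Σ t + (2π⁴)⁻¹ Σ site₆ ≤ ∫‖E_true‖² ≤ Σ_i ∫_(tube_i) ‖G‖²`; multiply by `2π⁴ > 0`. [folklore] -/
theorem FluxTubeDomination_of (h₁ : Sig.stub_trueFieldLowerBound) (h₂ : Sig.stub_confinedEnergyBound) :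
    FluxTubeDomination := by
  dsimp only [Sig.stub_trueFieldLowerBound, Sig.stub_confinedEnergyBound,
    FluxTubeDomination] at h₁ h₂ ⊢
  intro a ha N x hsep Ω G hdisj hmeas hG hvan hdiv
  obtain ⟨E, hE, hEdiv, horth, hlow⟩ := h₁ a ha N x hsep
  have hEG : ∀ φ : EuclideanSpace ℝ (Fin 8) → ℝ, ContDiff ℝ 1 φ → HasCompactSupport φ →
      ∫ y, inner ℝ (E y) (gradient φ y) = ∫ y, inner ℝ (G y) (gradient φ y) := by
    intro φ h1φ h2φ
    rw [hEdiv φ h1φ h2φ, hdiv φ h1φ h2φ]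
  have hb := h₂ N Ω E G hdisj hmeas hE hG horth hEG hvan
  have hpos : (0 : ℝ) < 2 * Real.pi ^ 4 := by positivity
  rw [Finset.sum_sub_distrib]
  have hkey : (2 * Real.pi ^ 4)⁻¹ * ∑ i, siteEnergy (fun r => (r⁻¹) ^ 6) x i
      ≤ (∑ i, ∫ y in {y | (fun y => (EuclideanSpace.equiv (Fin 3) ℝ).symm (fun k => y (Fin.castLE (by norm_num) k))) y ∈ Ω i}, ‖G y‖ ^ 2) - ∑ i, (fun a x₀ => sInf {e : ℝ | ∃ F : EuclideanSpace ℝ (Fin 8) → EuclideanSpace ℝ (Fin 8), MemLp F 2 volume ∧ (∀ φ : EuclideanSpace ℝ (Fin 8) → ℝ, ContDiff ℝ 1 φ → HasCompactSupport φ → ∫ y, inner ℝ (F y) (gradient φ y) = -(((volume (Metric.ball ((fun v => (EuclideanSpace.equiv (Fin 8) ℝ).symm (fun k => if h : (k : ℕ) < 3 then v ⟨k, h⟩ else 0)) x₀) a)).toReal)⁻¹ * ∫ y in Metric.ball ((fun v => (EuclideanSpace.equiv (Fin 8) ℝ).symm (fun k => if h : (k : ℕ) < 3 then v ⟨k, h⟩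 else 0)) x₀) a, φ y)) ∧ e = ∫ y, ‖F y‖ ^ 2}) a (x i) := by
    linarith
  calc ∑ i, siteEnergy (fun r => (r⁻¹) ^ 6) x i
      = 2 * Real.pi ^ 4 * ((2 * Real.pi ^ 4)⁻¹ * ∑ i, siteEnergy (fun r => (r⁻¹) ^ 6) x i) := by
        field_simp
    _ ≤ _ := mul_le_mul_of_nonneg_left hkey hpos.le

/-- **The closed skeleton instance**: the crux by name from the declared stubs (the only `sorry`s). -/
theorem FluxTubeDomination_skeleton :
    FluxTubeDomination :=
  FluxTubeDomination_of stub_trueFieldLowerBound stub_confinedEnergyBound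

/-- **The stand-in feeds the landed assembly**: `FluxTubeDomination` (this file) and the filed sibling
statement `RealisedCellKepler` give the parent crux `FluxTubeKepler.FluxCellKepler` by the landed
`FluxCellKeplerSplit.FluxCellKepler_of_subs` (p168076) — by `exact`, so the stand-in is verbatim. [folklore] -/
theorem feeds_assembly (h₁ : FluxTubeDomination)
    (h₂ : let ι : EuclideanSpace ℝ (Fin 3) → EuclideanSpace ℝ (Fin 8) := fun v => (EuclideanSpace.equiv (Fin 8) ℝ).symm (fun k => if h : (k : ℕ) < 3 then v ⟨k, h⟩ else 0); let π : EuclideanSpace ℝ (Fin 8) → EuclideanSpace ℝ (Fin 3) := fun y => (EuclideanSpace.equiv (Fin 3) ℝ).symm (fun k => y (Fin.castLE (by norm_num) k)); let t : ℝ → EuclideanSpace ℝ (Fin 3) → ℝ := fun a x₀ => sInf {e : ℝ | ∃ F : EuclideanSpace ℝ (Fin 8) → EuclideanSpace ℝ (Fin 8), MemLp F 2 volume ∧ (∀ φ : EuclideanSpace ℝ (Fin 8) → ℝ, ContDiff ℝ 1 φ → HasCompactSupport φ → ∫ y, inner ℝ (F y) (gradient φ y) = -(((volume (Metric.ball (ι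 x₀) a)).toReal)⁻¹ * ∫ y in Metric.ball (ι x₀) a, φ y)) ∧ e = ∫ y, ‖F y‖ ^ 2}; ∃ (R₁ : ℝ) (τ : Finset (EuclideanSpace ℝ (Fin 3)) → ℝ), (∀ (N : ℕ) (x : Fin N → EuclideanSpace ℝ (Fin 3)), Function.Injective x → ∃ a : ℝ, 0 < a ∧ (∀ i j, i ≠ j → 2 * a < dist (x i) (x j)) ∧ ∃ (Ω : Fin N → Set (EuclideanSpace ℝ (Fin 3))) (G : EuclideanSpace ℝ (Fin 8) → EuclideanSpace ℝ (Fin 8)), (Pairwise fun i j => Disjoint (Ω i) (Ω j)) ∧ (∀ i, MeasurableSet (Ω i)) ∧ MemLp G 2 volume ∧ (∀ y, π y ∉ (⋃ i, Ω i) → G y = 0) ∧ (∀ φ : EuclideanSpace ℝ (Fin 8) → ℝ, ContDiff ℝ 1 φ → HasCompactSupport φ → ∫ y, inner ℝ (G y) (gradient φ y) = -∑ i, ((volume (Metric.ball (ι (x i)) a)).toReal)⁻¹ * ∫ y in Metric.ball (ι (x i)) a, φ y) ∧ ∀ i, 2 * Real.pi ^ 4 * ((∫ y in {y | π y ∈ Ω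 i}, ‖G y‖ ^ 2) - t a (x i)) ≤ τ ((Finset.univ.filter fun j : Fin N => dist (x j) (x i) ≤ R₁).image fun j => x j - x i)) ∧ (∀ δ : ℝ, 0 < δ → ∀ R η : ℝ, 0 < R → 0 < η → ∃ c : ℝ, 0 < c ∧ ∀ (N : ℕ) (x : Fin N → EuclideanSpace ℝ (Fin 3)), Function.Injective x → (∀ i j, i ≠ j → δ ≤ dist (x i) (x j)) → c * (Nat.card {i : Fin N // ¬ ∃ a : ℝ, 47 / 50 ≤ a ∧ a ≤ 1 ∧ ∃ (A : EuclideanSpace ℝ (Fin 3) →ₗᵢ[ℝ] EuclideanSpace ℝ (Fin 3)) (s : ℤ → ℤ) (z : ℤ → ℝ), IsHaggSeq s ∧ (∀ m : ℤ, 39 / 50 * a ≤ z (m + 1) - z m ∧ z (m + 1) - z m ≤ 17 / 20 * a) ∧ let S : Set (EuclideanSpace ℝ (Fin 3)) := {p | ∃ m k l : ℤ, p = A (((k : ℝ) • triangularVec₁ a) + ((l : ℝ) • triangularVec₂ a) + ((haggLabel s m : ℝ) • barlowOffset a) + (z m • layerNormal 1))}; (∀ p ∈ S, ‖p‖ ≤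 R → ∃ j : Fin N, dist (x j - x i) p ≤ η) ∧ (∀ j : Fin N, ‖x j - x i‖ ≤ R → ∃ p ∈ S, dist (x j - x i) p ≤ η)} : ℝ) ≤ ∑ i, ((1 / 24 : ℝ) * siteEnergy (fun r => (r⁻¹) ^ 12) x i - (1 / 12 : ℝ) * τ ((Finset.univ.filter fun j : Fin N => dist (x j) (x i) ≤ R₁).image fun j => x j - x i)) - (N : ℝ) * ⨅ Q : PeriodicConfiguration 3, Q.energyPerParticle lennardJones)) :
    Summit.AtomisticToContinuum.Crystallization.Theses.FluxTubeKepler.FluxCellKepler :=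
  Summit.AtomisticToContinuum.Crystallization.Theorems.FluxCellKeplerSplit.FluxCellKepler_of_subs h₁ h₂

end Summit.AtomisticToContinuum.Crystallization.Cruxes.FluxCellKepler.SplitThomson
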